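import Summits.Ventures.PercRepro.RankLevelSetLevelSevenRowSeventyThree
import Summits.Ventures.PercRepro.RankLevelSetCoreSevenOfForm
import Summits.Ventures.PercRepro.RankLevelSetLevelSevenRowSeventyTwoForm
import Summits.Ventures.PercRepro.RankLevelSetLevelSevenRowSeventyTwoLarge

/-!
# PercRepro — THE ROW `72` OF LEVEL `7`: C-025 AT `q = 7` FOR EVERY FINITE MATROID AND EVERY `p ≥ 72` (p8, gen 18; a feeder
for S4 — the top of the `q = 7` window, from `73`)

Level `7` at rank `72` by the per-rank wrapper `rls_succ_large_at 6 7 72` (p8 g0, S3SixWindow): level `6` at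
`71` (`c025_six_all`) and the `e`-free core at `(72, d)` for every `d ≥ 8` — the cells `8 ≤ d ≤ 90` by their NUMERIC forms
(`quart_form72`, RankLevelSetLevelSevenRowSeventyTwoForm: the two inequalities of p2's `quart_form` at `p = 72`, `n = 72 + d`,
including the cell `(72, 72)` that has no polynomial form) through `c025_core_seven_of_form`, the coranks `d ≥ 91` by the
large-corank inequality at `(72, n ≥ 163)` (`largeSeven_all72`) through `c025_core_seven_large_of_ineq` (both
RankLevelSetCoreSevenOfForm). The rows `≥ 73` are `c025_seven_large_seventy_three`.
* **`c025_core_seven_at_seventy_two`** — the `e`-free core at rank `72`, every corank `d ≥ 8`;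
* **`c025_seven_at_seventy_two`** — level `7` at rank `72`, every finite matroid;
* **`c025_seven_large_seventy_two`** — level `7` for every `p ≥ 72`; **`c025_seven_seventy_two`** the same in the `C025` body.
Axioms: standard.
-/

open scoped Matroid

namespace PercRepro

namespace ThmN

variable {α : Type}

/-- **The `e`-free core of level `7` at rank `72`, every corank `d ≥ 8`**: the numeric forms of the cells `(72, 8 … 90)` and
the large-corank inequality at `(72, n ≥ 163)`. -/
theorem c025_core_seven_at_seventy_two (M : Matroid α) [M.Finite] (d : ℕ) (hd8 : 8 ≤ d) (hR : M.eRank = (72 : ℕ∞))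
    (hn : M.E.ncard = 72 + d) (hfree : EFree M) : RLS M 72 7 := by
  rcases Nat.lt_or_ge d 91 with h | h
  · exact c025_core_seven_of_form M 72 d hd8 hR hn hfree (quart_form72 d hd8 (by omega))
  · exact c025_core_seven_large_of_ineq M 72 hR (largeSeven_all72 M.E.ncard (by omega)) hfree

/-- **Level `7` at rank `72`, every finite matroid**: `rls_succ_large_at 6 7 72` on level `6` at `71` (`c025_six_all`), the
coranks `≤ 7` (`U = ∅` or Theorem M) and the core at `72`. -/
theorem c025_seven_at_seventy_two (M : Matroid α) [M.Finite] : RLS M 72 7 := by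
  refine rls_succ_large_at (α := α) 6 7 72 (by norm_num) (fun M _ => c025_six_all M 71 (by norm_num)) ?_ ?_ M
  · -- corank `≤ 7`: `U = ∅` or Theorem M
    intro M _ hn
    rcases Nat.lt_or_ge M.E.ncard (72 + 7) with h | h
    · exact RLS_of_ncard_lt M h
    · exact RLS_of_ncard_eq M (by omega)
  · -- the core at corank `≥ 8`
    intro M _ hR hbig hfree
    exact c025_core_seven_at_seventy_two M (M.E.ncard - 72) (by omega) hR (by omega) hfree

/-- **THEOREM C₇ AT `72`, UNCONDITIONAL OVER THE TREE**: every finite matroid satisfies C-025 at level `7` for every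
`p ≥ 72` — the row `72` by `c025_seven_at_seventy_two`, the rows `≥ 73` by `c025_seven_large_seventy_three`. -/
theorem c025_seven_large_seventy_two (M : Matroid α) [M.Finite] (p : ℕ) (hp : 72 ≤ p) : RLS M p 7 := by
  rcases Nat.lt_or_ge p 73 with h | h
  · have h72 : p = 72 := by omega
    subst h72
    exact c025_seven_at_seventy_two M
  · exact c025_seven_large_seventy_three M p h

/-- The same in the literal `C025` body: `phiK p 7 · #U(p, 7) ≤ #Y(p, 7)` for every finite matroid and every `p ≥ 72`. -/
theorem c025_seven_seventy_two (M : Matroid α) [M.Finite] (p : ℕ) (hp : 72 ≤ p) :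
    phiK p 7 * ({A : Set α | A ⊆ M.E ∧ M.eRk A = (p : ℕ∞) ∧ M.eRk (M.E \ A) = (7 : ℕ∞)}.ncard : ℚ) ≤
      ({A : Set α | A ⊆ M.E ∧ (7 : ℕ∞) < M.eRk A ∧ M.eRk A < (p : ℕ∞)}.ncard : ℚ) :=
  c025_seven_large_seventy_two M p hp

end ThmN

end PercRepro
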